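import Summits.BirchSwinnertonDyer.Rank1Residual.X2.NonPrimitiveLambdaLeMultiplicative
import Summits.BirchSwinnertonDyer.Rank1Residual.X2.ResidualDevissageMultiplicative
import HarnessLib

/-!
# GV §2 display (16) at an odd multiplicative Eisenstein prime, `E`-side, UPPER HALF — with NO
# datum record (T-GV23L) and NO trivial-zero record (A137/A137′):
# `#H¹(ℚ_Σ/ℚ_∞, Φ₀) · #S^{Σ₀}_{E[p]/Φ₀}(ℚ_∞) ≤ p^{λ_E + Σδ + e_p}` — cell `b2b-bsdres`, unit
# `b2b-bsdres-eisenstein-p2`, gen 30 (F7a)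

HONEST FRAMING (run/shared/lean/b2b/bsd-rank1-residual/, verbatim in every file): the goal of the
cell is to DELETE the COMBINATION-SHAPED residual classes of the Birch–Swinnerton-Dyer formula for
ALL analytic-rank `≤ 1` elliptic curves over `ℚ` — "full BSD formula for every rank `≤ 1` curve in
class `C`" assembled STRICTLY from published theorems — so that the rank-`≤ 1` remainder becomes
exactly the CONSTRUCTION-SHAPED classes, which are TYPED (missing-input `Prop`s), NOT attempted.
This is not "finishing BSD". Research route; NO CLAIM BEYOND STATED CLASSES; nothing here changes a
label. Theorems only; no definition, no named fact, no `sorry`.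

WHAT. Gen 13/16's `ResidualDevissageMultiplicative` proved the `E`-side of GV (16) at `p ‖ N` as an
EQUALITY `#H¹(ℚ_Σ/ℚ_∞, Φ₀) · #S^{Σ₀}_{E[p]/Φ₀}(ℚ_∞) = p^{λ(E) + Σδ + e}` from the registered facts
A133 (`λ(Sel^{Σ₀}) = λ(Sel) + Σδ`, in turn from the datum record T-GV23L) and, at a split prime,
A137 (`S^{str} < S_A`, from A137′). For the X2a closure only the INEQUALITY `≤` is load-bearing (the
reverse inequality is Wuthrich's divisibility `char X ∣ (L_p)`, A33, already a binder of the closure).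
Gen 30 proved the upper half `λ(Sel^{Σ₀}) ≤ λ(Sel) + Σδ` for BAD `Σ₀` in the kernel from A40/A41
(`NonPrimitiveLambdaLeSplit.lambda_nonPrimitive_le_add_sum_delta_multiplicative`); this file
re-threads the two counts with it:

* `finite_torsionBy_and_zpCorank_nonPrimitiveSelmerInfty_le` — `Sel^{Σ₀}[p]` finite and
  `corank Sel^{Σ₀} ≤ λ(D) + Σδ`;
* `exists_data_count_le_of_not_split` / `exists_data_count_le_of_split` — the Tate data `L` of A41 /
  A40 with `#(S^{Σ₀}_A(L) ⊓ H¹[p]) ≤ p^{λ(D) + Σδ}` resp. `≤ p^{λ(D) + Σδ + 1}` (split: corank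
  additivity along the trivial-zero map `S^{Σ₀}_A → D`, whose image has corank `≤ 1` because
  `#D[p] = p` — no strictness `S^{str} < S_A` needed);
* **`natCard_line_mul_quotSelmer_le_of_not_split`**, **`natCard_line_mul_quotSelmer_le_of_split`** —
  the displayed inequality, by gen 16's devissage identity.

Hypotheses: A40/A41 (`hT`, `hT'`), A135 (`hB`, divisibility), `Σ₀ ∌ p` finite consisting of BAD
places and containing every bad place `≠ p`, `D` f.g. torsion with `μ = 0`, the line `Φ₀` ramified
at `p` and even, the lifting property. NOT used: A133, A137, A137′, T-GV23L.

References: [GreenbergVatsal2000] §1 (5)–(7), §2 pp. 14–16, 25, 28–30, Props. (2.4), (2.5), (2.8),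
display (16); [SilvermanATAEC1994] V.5.3–5.4; HOME/b2b-bsdres-eisenstein-p2/X2-GAP.md §35.
-/

set_option autoImplicit false

noncomputable section

open scoped Classical AddSubgroup

namespace Summit.BirchSwinnertonDyer.Rank1Residual.X2.GreenbergSelmerCountLe

open NumberField IsDedekindDomain Field Literature.NumberTheory.GaloisRepresentations
  Literature.NumberTheory.EllipticCurves Literature.NumberTheory.EllipticCurves.GreenbergSelmer
  Literature.NumberTheory.EllipticCurves.GreenbergVatsal2000 IsDedekindDomain.HeightOneSpectrum
  Literature.NumberTheory.EllipticCurves.Rank1Residual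
  Summit.BirchSwinnertonDyer.Rank1Residual.X2.GreenbergVatsalTorsion
  Summit.BirchSwinnertonDyer.Rank1Residual.X2.GreenbergVatsalStrictSelmer
  Summit.BirchSwinnertonDyer.Rank1Residual.X2.GreenbergVatsalTateDatum
  Summit.BirchSwinnertonDyer.Rank1Residual.X2.GreenbergVatsalTateDatumSign
  Summit.BirchSwinnertonDyer.Rank1Residual.X2.GreenbergVatsalTateDatumTorsion
  Summit.BirchSwinnertonDyer.Rank1Residual.X2.NonPrimitiveSelmerStrictEquality
  Summit.BirchSwinnertonDyer.Rank1Residual.X2.GreenbergVatsalStrictSelmerMultiplicative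
  Summit.BirchSwinnertonDyer.Rank1Residual.X2.GreenbergVatsalTateDatumCofree
  Summit.BirchSwinnertonDyer.Rank1Residual.X2.NonPrimitiveSelmerCorank
  Summit.BirchSwinnertonDyer.Rank1Residual.X2.NonPrimitiveSelmerTorsionCard
  Summit.BirchSwinnertonDyer.Rank1Residual.X2.GreenbergSelmerCountNonsplit
  Summit.BirchSwinnertonDyer.Rank1Residual.X2.GreenbergSelmerCountSplit
  Summit.BirchSwinnertonDyer.Rank1Residual.X2.TrivialZeroQuotient
  Summit.BirchSwinnertonDyer.Rank1Residual.X2.TrivialZeroCorankAlgebra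
  Summit.BirchSwinnertonDyer.Rank1Residual.X2.ResidualDevissageModules
  Summit.BirchSwinnertonDyer.Rank1Residual.X2.ResidualDevissageSelmer
  Summit.BirchSwinnertonDyer.Rank1Residual.X2.ResidualDevissageLine
  Summit.BirchSwinnertonDyer.Rank1Residual.X2.ResidualDevissageNoTorsion
  Summit.BirchSwinnertonDyer.Rank1Residual.X2.ResidualDevissageMultiplicative

variable (W : WeierstrassCurve ℚ) [W.IsGloballyMinimal] [W.IsElliptic] (p : ℕ) [hp : Fact p.Prime]
  (κ : ZpExtension ℚ p) {γ : absoluteGaloisGroup ℚ} (S₀ : Finset (HeightOneSpectrum (𝓞 ℚ)))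

/-! ## §0. `Sel^{Σ₀}[p]` finite and `corank Sel^{Σ₀} ≤ λ(E) + Σδ` (bad `Σ₀ ∌ p`, `μ(E) = 0`) -/

/-- **`Sel^{Σ₀}_E(ℚ_∞)_p[p]` is finite and `corank_{ℤ_p} Sel^{Σ₀} ≤ λ(E) + Σ_{v∈Σ₀} δ_E^{(v)}`** at an
odd multiplicative `p`, for BAD `Σ₀ ∌ p` and a f.g. torsion dual datum `D` with `μ = 0`: the kernel's
dual datum `nonPrimitiveDualData` of `Sel^{Σ₀}` is f.g. torsion with `μ = μ(D) = 0` and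
`λ ≤ λ(D) + Σδ` (gen 30, from A40/A41), and `corank Sel^{Σ₀} = λ` of its dual.
[cite: GreenbergVatsal2000, §1 (5)–(7) pp. 7–8; §2 Cor. (2.3), Prop. (2.4)] [cite: GreenbergLNM1716, §1 p. 60] -/
theorem finite_torsionBy_and_zpCorank_nonPrimitiveSelmerInfty_le
    (hT : Silverman1994_thmV53_tateUniformisation.{0})
    (hT' : Silverman1994_thmV53_corV54_tateUniformisation.{0})
    (hκ : κ.IsCyclotomic) (hγ : κ.IsTopGenerator γ) (hp2 : p ≠ 2)
    (hmult : W.HasMultiplicativeReductionAtPrime p)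
    (hS₀ : ∀ v ∈ S₀, ((p : ℕ) : 𝓞 ℚ) ∉ v.asIdeal) (hbad : ∀ v ∈ S₀, ¬ W.HasGoodReductionAt v)
    (D : W.SelmerDualData κ γ) [Module.Finite (IwasawaAlgebra p) D.X] (hX : D.IsTorsion)
    (hμ : D.mu = 0) :
    Finite ((nonPrimitiveSelmerInfty W κ (↑S₀ : Set (HeightOneSpectrum (𝓞 ℚ))))[(p : ℤ)]) ∧
      zpCorank (nonPrimitiveSelmerInfty W κ (↑S₀ : Set (HeightOneSpectrum (𝓞 ℚ)))) p ≤
        lambdaInvariant p D.X + ∑ v ∈ S₀, delta W p v := by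
  obtain ⟨hfg, htors, hmu, hlam⟩ :=
    NonPrimitiveLambdaLeSplit.lambda_nonPrimitive_le_add_sum_delta_multiplicative hT hT' W p hp2 hmult
      κ hκ γ hγ S₀ hS₀ hbad D
      (NonPrimitiveSelmerDual.nonPrimitiveDualData W κ (↑S₀ : Set (HeightOneSpectrum (𝓞 ℚ))) hγ) hX
  haveI := hfg
  have hμ0 : muInvariant p
      (NonPrimitiveSelmerDual.nonPrimitiveDualData W κ (↑S₀ : Set (HeightOneSpectrum (𝓞 ℚ))) hγ).X =
        0 := by
    rw [hmu]; exact hμ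
  obtain ⟨hfin, hcork⟩ := finite_torsionBy_and_zpCorank_eq_lambdaInvariant p _ htors hμ0
    (isPrimary_nonPrimitiveSelmerInfty W S₀) (NonPrimitiveSelmerDual.toDualEquiv W κ _ _)
  exact ⟨hfin, hcork.trans_le hlam⟩

/-! ## §1. The counts `#(S^{Σ₀}_A(L) ⊓ H¹[p]) ≤ p^{λ + Σδ + e}` for the Tate data -/

/-- **NON-SPLIT odd `p ‖ N`, upper half**: the Tate data `L` of A41 (`exists_data_of_not_split`)
with `htriv`, `hgen`, `#(C ∩ E[p^∞][p]) = p`, `Sel^{Σ₀} = S^{Σ₀}_A` and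
`#(S^{Σ₀}_A(ℚ_∞) ⊓ H¹[p]) ≤ p^{λ(E) + Σδ}` — gen 13's `exists_data_count_of_not_split` with A133
replaced by §0 (divisibility of `S^{Σ₀}`: A135). [cite: GreenbergVatsal2000, §1 (5)–(7) pp. 7–8; §2 pp. 14–16, Prop. (2.5), p. 25] -/
theorem exists_data_count_le_of_not_split
    (hT : Silverman1994_thmV53_tateUniformisation.{0})
    (hT' : Silverman1994_thmV53_corV54_tateUniformisation.{0})
    (hB : datumSelmer_divisible_of_finite_torsionBy)
    (hκ : κ.IsCyclotomic) (hγ : κ.IsTopGenerator γ) (hp2 : p ≠ 2)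
    (hmult : W.HasMultiplicativeReductionAtPrime p) (hns : ¬ W.HasSplitMultiplicativeReductionAtPrime p)
    (hS₀ : ∀ v ∈ S₀, ((p : ℕ) : 𝓞 ℚ) ∉ v.asIdeal) (hbad : ∀ v ∈ S₀, ¬ W.HasGoodReductionAt v)
    (hS : ∀ v : HeightOneSpectrum (𝓞 ℚ), v ∉ S₀ → ((p : ℕ) : 𝓞 ℚ) ∉ v.asIdeal →
      W.HasGoodReductionAt v)
    (D : W.SelmerDualData κ γ) [Module.Finite (IwasawaAlgebra p) D.X] (hX : D.IsTorsion)
    (hμ : D.mu = 0) :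
    ∃ L : Data ℚ (W.geomPrimaryTorsion p) p,
      (∀ (v : HeightOneSpectrum (𝓞 ℚ)) (hv : ((p : ℕ) : 𝓞 ℚ) ∈ v.asIdeal),
        ∀ x ∈ inertia v, ∀ m : W.geomPrimaryTorsion p, x • m - m ∈ (L v hv).plus) ∧
      (∀ (v : HeightOneSpectrum (𝓞 ℚ)) (hv : ((p : ℕ) : 𝓞 ℚ) ∈ v.asIdeal),
        ∀ c ∈ (torsionData L p v hv).plus, ∃ τ ∈ inertia v,
          ∃ c' ∈ (torsionData L p v hv).plus, τ • c' - c' = c) ∧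
      (∀ (v : HeightOneSpectrum (𝓞 ℚ)) (hv : ((p : ℕ) : 𝓞 ℚ) ∈ v.asIdeal),
        Nat.card ↥((L v hv).plus ⊓ (↥(W.geomPrimaryTorsion p))[(p : ℤ)]) = p) ∧
      nonPrimitiveSelmerInfty W κ (↑S₀ : Set (HeightOneSpectrum (𝓞 ℚ))) =
        gvSelmerInfty κ (W.geomPrimaryTorsion p) L (↑S₀ : Set (HeightOneSpectrum (𝓞 ℚ))) ∧
      Nat.card ↥(gvSelmerInfty κ (W.geomPrimaryTorsion p) L (↑S₀ : Set (HeightOneSpectrum (𝓞 ℚ))) ⊓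
          (subgroupH1 κ.kerSubgroup (W.geomPrimaryTorsion p))[(p : ℤ)]) ≤
        p ^ (lambdaInvariant p D.X + ∑ v ∈ S₀, delta W p v) := by
  obtain ⟨L, htriv, hgen, hC, heqK, hle, hge⟩ :=
    exists_data_of_not_split W p κ hT' hκ hp2 hmult hns
  set S₀' : Set (HeightOneSpectrum (𝓞 ℚ)) := ↑S₀ with hS₀'
  have hS₀'' : ∀ v ∈ S₀', ((p : ℕ) : 𝓞 ℚ) ∉ v.asIdeal := fun v hv ↦ hS₀ v (Finset.mem_coe.1 hv)
  have hS' : ∀ v : HeightOneSpectrum (𝓞 ℚ), v ∉ S₀' → ((p : ℕ) : 𝓞 ℚ) ∉ v.asIdeal →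
      W.HasGoodReductionAt v := fun v hv hpv ↦ hS v (fun h ↦ hv (Finset.mem_coe.2 h)) hpv
  -- `Sel^{Σ₀} = S^{Σ₀,str} = S^{Σ₀}`
  have heq₁ : nonPrimitiveSelmerInfty W κ S₀' =
      gvStrictSelmerInfty κ (W.geomPrimaryTorsion p) L S₀' :=
    nonPrimitiveSelmerInfty_eq_gvStrictSelmerInfty_of_le W p κ L S₀' hp2 hκ hS₀'' hS' hle hge
  have heq₂ : gvStrictSelmerInfty κ (W.geomPrimaryTorsion p) L S₀' =
      gvSelmerInfty κ (W.geomPrimaryTorsion p) L S₀' :=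
    gvStrictSelmerInfty_eq_gvSelmerInfty_of_forall_eq κ (W.geomPrimaryTorsion p) L S₀' heqK
  have heq : nonPrimitiveSelmerInfty W κ S₀' = gvSelmerInfty κ (W.geomPrimaryTorsion p) L S₀' :=
    heq₁.trans heq₂
  -- corank bound and finiteness of `Sel^{Σ₀}[p]` (GV (7) at `p ‖ N`, upper half)
  obtain ⟨hfin, hcork⟩ :=
    finite_torsionBy_and_zpCorank_nonPrimitiveSelmerInfty_le W p κ S₀ hT hT' hκ hγ hp2 hmult hS₀ hbad
      D hX hμ
  haveI := hfin
  -- finiteness of `S^{Σ₀} ⊓ H¹[p]`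
  haveI hfinS : Finite ↥(gvSelmerInfty κ (W.geomPrimaryTorsion p) L S₀' ⊓
      (subgroupH1 κ.kerSubgroup (W.geomPrimaryTorsion p))[(p : ℤ)]) := by
    rw [← heq, finite_inf_torsionBy_iff]; exact hfin
  -- divisibility of `S^{Σ₀}` (GV Prop. (2.5) / p. 25)
  have hdiv : ∀ s : nonPrimitiveSelmerInfty W κ S₀', ∃ t : nonPrimitiveSelmerInfty W κ S₀',
      p • t = s := by
    intro s
    have hs : (s : W.subgroupH1 p κ.kerSubgroup) ∈
        datumSelmerInfty κ (W.geomPrimaryTorsion p) L S₀' := by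
      rw [← gvSelmerInfty_eq_datumSelmerInfty, ← heq]; exact s.2
    obtain ⟨t, ht, hts⟩ := hB W p hp2 κ hκ L hC htriv S₀ hS₀ hS hfinS (s : W.subgroupH1 p κ.kerSubgroup)
      hs
    have ht' : t ∈ nonPrimitiveSelmerInfty W κ S₀' := by
      rw [heq]; exact ht
    exact ⟨⟨t, ht'⟩, Subtype.ext (by rw [AddSubgroupClass.coe_nsmul]; exact hts)⟩
  refine ⟨L, htriv, hgen, fun v hv ↦ (hC v hv).2, heq, ?_⟩
  rw [← heq, natCard_inf_torsionBy_eq,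
    natCard_torsionBy_eq_pow_zpCorank_of_divisible p (isPrimary_nonPrimitiveSelmerInfty W S₀) hdiv]
  exact Nat.pow_le_pow_right hp.out.pos hcork

/-- **SPLIT odd `p ‖ N`, upper half**: the Tate data `L` of A40 (`exists_data_of_split`) with
`htriv`, `hgen`, `#(C ∩ E[p^∞][p]) = p`, `Sel^{Σ₀} = S^{Σ₀,str}` and
`#(S^{Σ₀}_A(ℚ_∞) ⊓ H¹[p]) ≤ p^{λ(E) + Σδ + 1}` — gen 13's `exists_data_count_of_split` with A133
replaced by §0 and WITHOUT A137: `corank S^{Σ₀}_A = corank Sel^{Σ₀} + corank Φ(S^{Σ₀}_A)` along the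
trivial-zero map `Φ : S^{Σ₀}_A → D` (kernel `S^{Σ₀,str} = Sel^{Σ₀}`), and `corank Φ(S^{Σ₀}_A) ≤ 1`
since `Φ(S^{Σ₀}_A)[p] ↪ D[p]` has order `≤ p`. [cite: GreenbergVatsal2000, §1 (5)–(7) pp. 7–8, pp. 14–15; §2 Prop. (2.1), (2.5), pp. 20, 25] -/
theorem exists_data_count_le_of_split
    (hT : Silverman1994_thmV53_tateUniformisation.{0})
    (hT' : Silverman1994_thmV53_corV54_tateUniformisation.{0})
    (hB : datumSelmer_divisible_of_finite_torsionBy)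
    (hκ : κ.IsCyclotomic) (hγ : κ.IsTopGenerator γ) (hp2 : p ≠ 2)
    (hsplit : W.HasSplitMultiplicativeReductionAtPrime p)
    (hS₀ : ∀ v ∈ S₀, ((p : ℕ) : 𝓞 ℚ) ∉ v.asIdeal) (hbad : ∀ v ∈ S₀, ¬ W.HasGoodReductionAt v)
    (hS : ∀ v : HeightOneSpectrum (𝓞 ℚ), v ∉ S₀ → ((p : ℕ) : 𝓞 ℚ) ∉ v.asIdeal →
      W.HasGoodReductionAt v)
    (D : W.SelmerDualData κ γ) [Module.Finite (IwasawaAlgebra p) D.X] (hX : D.IsTorsion)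
    (hμ : D.mu = 0) :
    ∃ L : Data ℚ (W.geomPrimaryTorsion p) p,
      (∀ (v : HeightOneSpectrum (𝓞 ℚ)) (hv : ((p : ℕ) : 𝓞 ℚ) ∈ v.asIdeal),
        ∀ x ∈ inertia v, ∀ m : W.geomPrimaryTorsion p, x • m - m ∈ (L v hv).plus) ∧
      (∀ (v : HeightOneSpectrum (𝓞 ℚ)) (hv : ((p : ℕ) : 𝓞 ℚ) ∈ v.asIdeal),
        ∀ c ∈ (torsionData L p v hv).plus, ∃ τ ∈ inertia v,
          ∃ c' ∈ (torsionData L p v hv).plus, τ • c' - c' = c) ∧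
      (∀ (v : HeightOneSpectrum (𝓞 ℚ)) (hv : ((p : ℕ) : 𝓞 ℚ) ∈ v.asIdeal),
        Nat.card ↥((L v hv).plus ⊓ (↥(W.geomPrimaryTorsion p))[(p : ℤ)]) = p) ∧
      nonPrimitiveSelmerInfty W κ (↑S₀ : Set (HeightOneSpectrum (𝓞 ℚ))) =
        gvStrictSelmerInfty κ (W.geomPrimaryTorsion p) L (↑S₀ : Set (HeightOneSpectrum (𝓞 ℚ))) ∧
      Nat.card ↥(gvSelmerInfty κ (W.geomPrimaryTorsion p) L (↑S₀ : Set (HeightOneSpectrum (𝓞 ℚ))) ⊓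
          (subgroupH1 κ.kerSubgroup (W.geomPrimaryTorsion p))[(p : ℤ)]) ≤
        p ^ (lambdaInvariant p D.X + ∑ v ∈ S₀, delta W p v + 1) := by
  have hmult : W.HasMultiplicativeReductionAtPrime p := hsplit.hasMultiplicativeReductionAtPrime
  obtain ⟨L, htriv, hgen, hC, htrivD, hle, hge⟩ := exists_data_of_split W p κ hT hp2 hsplit
  -- the place above `p`
  set v₀ : HeightOneSpectrum (𝓞 ℚ) := (Rat.HeightOneSpectrum.primesEquiv (R := 𝓞 ℚ)).symm ⟨p, hp.out⟩
    with hv₀def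
  have hv₀ : ((p : ℕ) : 𝓞 ℚ) ∈ v₀.asIdeal :=
    (natCast_mem_asIdeal_iff_eq_primesEquiv_symm v₀ hp.out).mpr hv₀def
  have hS₀'' : ∀ v ∈ (↑S₀ : Set (HeightOneSpectrum (𝓞 ℚ))), ((p : ℕ) : 𝓞 ℚ) ∉ v.asIdeal :=
    fun v hv ↦ hS₀ v (Finset.mem_coe.1 hv)
  have hS' : ∀ v : HeightOneSpectrum (𝓞 ℚ), v ∉ (↑S₀ : Set (HeightOneSpectrum (𝓞 ℚ))) →
      ((p : ℕ) : 𝓞 ℚ) ∉ v.asIdeal → W.HasGoodReductionAt v :=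
    fun v hv hpv ↦ hS v (fun h ↦ hv (Finset.mem_coe.2 h)) hpv
  -- `T := Sel^{Σ₀} = S^{Σ₀,str} ≤ S := S^{Σ₀}`
  have heqT : nonPrimitiveSelmerInfty W κ (↑S₀ : Set (HeightOneSpectrum (𝓞 ℚ))) =
      gvStrictSelmerInfty κ (W.geomPrimaryTorsion p) L ↑S₀ :=
    nonPrimitiveSelmerInfty_eq_gvStrictSelmerInfty_of_le W p κ L _ hp2 hκ hS₀'' hS' hle hge
  have hTS : nonPrimitiveSelmerInfty W κ (↑S₀ : Set (HeightOneSpectrum (𝓞 ℚ))) ≤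
      gvSelmerInfty κ (W.geomPrimaryTorsion p) L ↑S₀ :=
    heqT.le.trans (gvStrictSelmerInfty_le_gvSelmerInfty κ _ L _)
  -- (a) corank bound and finiteness of `T[p]`
  obtain ⟨hfinT, hcorkT⟩ :=
    finite_torsionBy_and_zpCorank_nonPrimitiveSelmerInfty_le W p κ S₀ hT hT' hκ hγ hp2 hmult hS₀ hbad
      D hX hμ
  haveI := hfinT
  -- (b) the trivial-zero map `Φ : S → D` with kernel `T`
  obtain ⟨Φ, hΦ⟩ := exists_trivialZeroHom W p κ L htrivD (↑S₀ : Set (HeightOneSpectrum (𝓞 ℚ))) hκ hv₀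
  have hΦT : ∀ c : ↥(gvSelmerInfty κ (W.geomPrimaryTorsion p) L ↑S₀),
      Φ c = 0 ↔ (c : W.subgroupH1 p κ.kerSubgroup) ∈
        nonPrimitiveSelmerInfty W κ (↑S₀ : Set (HeightOneSpectrum (𝓞 ℚ))) := fun c ↦ by
    rw [hΦ c, heqT]
  -- (c) `D[p]` finite of order `p`
  obtain ⟨hfinGr, hcardGr⟩ :=
    finite_and_natCard_torsionBy_gr W p (L v₀ hv₀) (hC v₀ hv₀).1 (hC v₀ hv₀).2
  haveI := hfinGr
  -- (d) `S[p]` finite (kernel `↪ T[p]`, target `D[p]`)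
  haveI hfinS : Finite ((↥(gvSelmerInfty κ (W.geomPrimaryTorsion p) L ↑S₀))[(p : ℤ)]) :=
    finite_torsionBy_of_hom Φ hΦT
  have hfinS' : Finite ↥(gvSelmerInfty κ (W.geomPrimaryTorsion p) L ↑S₀ ⊓
      (subgroupH1 κ.kerSubgroup (W.geomPrimaryTorsion p))[(p : ℤ)]) :=
    (finite_inf_torsionBy_iff _ _).2 hfinS
  -- (e) `S` divisible (GV Prop. (2.5) / p. 25)
  have hdiv : ∀ s : ↥(gvSelmerInfty κ (W.geomPrimaryTorsion p) L ↑S₀),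
      ∃ t : ↥(gvSelmerInfty κ (W.geomPrimaryTorsion p) L ↑S₀), p • t = s := by
    intro s
    obtain ⟨t, ht, hts⟩ := hB W p hp2 κ hκ L hC htriv S₀ hS₀ hS hfinS'
      (s : W.subgroupH1 p κ.kerSubgroup) s.2
    exact ⟨⟨t, ht⟩, Subtype.ext (by rw [AddSubgroupClass.coe_nsmul]; exact hts)⟩
  -- (f) `corank S = corank T + corank R`, `R = Φ(S)`
  have hprimS : ∀ s : ↥(gvSelmerInfty κ (W.geomPrimaryTorsion p) L ↑S₀), ∃ n : ℕ, p ^ n • s = 0 :=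
    fun s ↦ by
    obtain ⟨n, hn⟩ := W.exists_pow_smul_subgroupH1_ker_eq_zero κ (s : W.subgroupH1 p κ.kerSubgroup)
    exact ⟨n, Subtype.ext (by rw [AddSubgroupClass.coe_nsmul]; exact hn)⟩
  have hadd := zpCorank_eq_add_of_hom p hTS Φ hΦT hprimS
  -- (g) `corank R ≤ 1`: `R[p] ↪ D[p]` has order dividing `p`
  obtain ⟨hfinR, hdvd⟩ := finite_and_natCard_torsionBy_dvd_of_le (p : ℤ) Φ.range
  haveI := hfinR
  rw [hcardGr] at hdvd
  have hR : zpCorank (↥Φ.range) p ≤ 1 :=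
    NonPrimitiveQuotientCorank.zpCorank_le_one_of_natCard_torsionBy_le (Nat.le_of_dvd hp.out.pos hdvd)
  -- (h) assemble
  refine ⟨L, htriv, hgen, fun v hv ↦ (hC v hv).2, heqT, ?_⟩
  rw [natCard_inf_torsionBy_eq, natCard_torsionBy_eq_pow_zpCorank_of_divisible p hprimS hdiv, hadd]
  exact Nat.pow_le_pow_right hp.out.pos (add_le_add hcorkT hR)

/-! ## §2. Display (16) at `p ‖ N`, `E`-side, upper half -/

variable {Φ₀ : AddSubgroup (W.geomTorsion (p : ℤ))} (hΦ : IsRationalLine W p Φ₀)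

/-- **GV (16) at a NON-SPLIT odd `p ‖ N`, `E`-side, upper half:**
`#H¹(ℚ_Σ/ℚ_∞, Φ₀) · #S^{Σ₀}_{E[p]/Φ₀}(ℚ_∞) ≤ p^{λ(E) + Σ_{v∈Σ₀} δ_v}` for a rational line `Φ₀`
ramified at `p` and even, `μ(E) = 0`, bad `Σ₀ ∌ p` containing the bad places `≠ p`, granted A40/A41,
A135 and the lifting property (gen 16's devissage identity + §1).
[cite: GreenbergVatsal2000, §2 pp. 25, 28–30 (display (16))] -/
theorem natCard_line_mul_quotSelmer_le_of_not_split
    (hT : Silverman1994_thmV53_tateUniformisation.{0})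
    (hT' : Silverman1994_thmV53_corV54_tateUniformisation.{0})
    (hB : datumSelmer_divisible_of_finite_torsionBy)
    (hκ : κ.IsCyclotomic) (hγ : κ.IsTopGenerator γ) (hp2 : p ≠ 2)
    (hmult : W.HasMultiplicativeReductionAtPrime p) (hns : ¬ W.HasSplitMultiplicativeReductionAtPrime p)
    (hS₀ : ∀ v ∈ S₀, ((p : ℕ) : 𝓞 ℚ) ∉ v.asIdeal) (hbad : ∀ v ∈ S₀, ¬ W.HasGoodReductionAt v)
    (hS : ∀ v : HeightOneSpectrum (𝓞 ℚ), v ∉ S₀ → ((p : ℕ) : 𝓞 ℚ) ∉ v.asIdeal →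
      W.HasGoodReductionAt v)
    (D : W.SelmerDualData κ γ) [Module.Finite (IwasawaAlgebra p) D.X] (hX : D.IsTorsion)
    (hμ : D.mu = 0) (hram : ¬ LineUnramifiedAt W p Φ₀) (heven : LineEven W p Φ₀)
    (hlift : ∀ s ∈ ResidualDevissageSelmer.quotSelmer κ.kerSubgroup
        (ResidualDevissageLine.lineSub Φ₀ hΦ).Quot p (↑S₀ : Set (HeightOneSpectrum (𝓞 ℚ))),
      ∃ x ∈ GreenbergVatsal2000.unramifiedOutside κ.kerSubgroup
          ↥((↥(W.geomPrimaryTorsion p))[(p : ℤ)]) p (↑S₀ : Set (HeightOneSpectrum (𝓞 ℚ))),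
        ResidualDevissageSelmer.subH1 κ.kerSubgroup (ResidualDevissageLine.lineSub Φ₀ hΦ).proj
          (ResidualDevissageLine.lineSub Φ₀ hΦ).proj_smul x = s) :
    Nat.card (GreenbergVatsal2000.unramifiedOutside κ.kerSubgroup
        (ResidualDevissageLine.lineSub Φ₀ hΦ).Sub p (↑S₀ : Set (HeightOneSpectrum (𝓞 ℚ)))) *
      Nat.card (ResidualDevissageSelmer.quotSelmer κ.kerSubgroup
        (ResidualDevissageLine.lineSub Φ₀ hΦ).Quot p (↑S₀ : Set (HeightOneSpectrum (𝓞 ℚ)))) ≤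
    p ^ (lambdaInvariant p D.X + ∑ v ∈ S₀, delta W p v) := by
  obtain ⟨L, htriv, -, hcard, -, hcount⟩ :=
    exists_data_count_le_of_not_split W p κ S₀ hT hT' hB hκ hγ hp2 hmult hns hS₀ hbad hS D hX hμ
  have hS' : ∀ v : HeightOneSpectrum (𝓞 ℚ), v ∉ (↑S₀ : Set (HeightOneSpectrum (𝓞 ℚ))) →
      ((p : ℕ) : 𝓞 ℚ) ∉ v.asIdeal → W.HasGoodReductionAt v :=
    fun v hv hpv ↦ hS v (fun h ↦ hv (Finset.mem_coe.2 h)) hpv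
  obtain ⟨c, hc⟩ := exists_isComplexConjugation (Rat.castHom ℝ)
  have hdev := ResidualDevissageLine.natCard_gvSelmer_torsion_eq_mul_of_line hΦ hp2 hram heven L
    htriv hcard (↑S₀ : Set (HeightOneSpectrum (𝓞 ℚ))) hS' κ.kerSubgroup
    (ResidualDevissageLine.mem_kerSubgroup_of_isComplexConjugation κ hc) hc hlift
  have h28 := GreenbergVatsalTorsionCurve.natCard_gvSelmer_torsion_curve W p κ.kerSubgroup L
    (↑S₀ : Set (HeightOneSpectrum (𝓞 ℚ))) hS' htriv
  rw [← hdev, h28, natCard_fixedPoints_quot_eq_one_of_line W p κ hΦ hT' hp2 hmult hκ hram heven,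
    mul_one]
  change Nat.card ↥(gvSelmerInfty κ (W.geomPrimaryTorsion p) L ↑S₀ ⊓ _) ≤ _
  exact hcount

/-- **GV (16) at a SPLIT odd `p ‖ N`, `E`-side, upper half (trivial zero included):**
`#H¹(ℚ_Σ/ℚ_∞, Φ₀) · #S^{Σ₀}_{E[p]/Φ₀}(ℚ_∞) ≤ p^{λ(E) + Σ_{v∈Σ₀} δ_v + 1}`, same hypotheses (no
A133, no A137). [cite: GreenbergVatsal2000, §2 pp. 14–15, 25, 28–30 (display (16))] -/
theorem natCard_line_mul_quotSelmer_le_of_split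
    (hT : Silverman1994_thmV53_tateUniformisation.{0})
    (hT' : Silverman1994_thmV53_corV54_tateUniformisation.{0})
    (hB : datumSelmer_divisible_of_finite_torsionBy)
    (hκ : κ.IsCyclotomic) (hγ : κ.IsTopGenerator γ) (hp2 : p ≠ 2)
    (hsplit : W.HasSplitMultiplicativeReductionAtPrime p)
    (hS₀ : ∀ v ∈ S₀, ((p : ℕ) : 𝓞 ℚ) ∉ v.asIdeal) (hbad : ∀ v ∈ S₀, ¬ W.HasGoodReductionAt v)
    (hS : ∀ v : HeightOneSpectrum (𝓞 ℚ), v ∉ S₀ → ((p : ℕ) : 𝓞 ℚ) ∉ v.asIdeal →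
      W.HasGoodReductionAt v)
    (D : W.SelmerDualData κ γ) [Module.Finite (IwasawaAlgebra p) D.X] (hX : D.IsTorsion)
    (hμ : D.mu = 0) (hram : ¬ LineUnramifiedAt W p Φ₀) (heven : LineEven W p Φ₀)
    (hlift : ∀ s ∈ ResidualDevissageSelmer.quotSelmer κ.kerSubgroup
        (ResidualDevissageLine.lineSub Φ₀ hΦ).Quot p (↑S₀ : Set (HeightOneSpectrum (𝓞 ℚ))),
      ∃ x ∈ GreenbergVatsal2000.unramifiedOutside κ.kerSubgroup
          ↥((↥(W.geomPrimaryTorsion p))[(p : ℤ)]) p (↑S₀ : Set (HeightOneSpectrum (𝓞 ℚ))),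
        ResidualDevissageSelmer.subH1 κ.kerSubgroup (ResidualDevissageLine.lineSub Φ₀ hΦ).proj
          (ResidualDevissageLine.lineSub Φ₀ hΦ).proj_smul x = s) :
    Nat.card (GreenbergVatsal2000.unramifiedOutside κ.kerSubgroup
        (ResidualDevissageLine.lineSub Φ₀ hΦ).Sub p (↑S₀ : Set (HeightOneSpectrum (𝓞 ℚ)))) *
      Nat.card (ResidualDevissageSelmer.quotSelmer κ.kerSubgroup
        (ResidualDevissageLine.lineSub Φ₀ hΦ).Quot p (↑S₀ : Set (HeightOneSpectrum (𝓞 ℚ)))) ≤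
    p ^ (lambdaInvariant p D.X + ∑ v ∈ S₀, delta W p v + 1) := by
  obtain ⟨L, htriv, -, hcard, -, hcount⟩ :=
    exists_data_count_le_of_split W p κ S₀ hT hT' hB hκ hγ hp2 hsplit hS₀ hbad hS D hX hμ
  have hS' : ∀ v : HeightOneSpectrum (𝓞 ℚ), v ∉ (↑S₀ : Set (HeightOneSpectrum (𝓞 ℚ))) →
      ((p : ℕ) : 𝓞 ℚ) ∉ v.asIdeal → W.HasGoodReductionAt v :=
    fun v hv hpv ↦ hS v (fun h ↦ hv (Finset.mem_coe.2 h)) hpv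
  obtain ⟨c, hc⟩ := exists_isComplexConjugation (Rat.castHom ℝ)
  have hdev := ResidualDevissageLine.natCard_gvSelmer_torsion_eq_mul_of_line hΦ hp2 hram heven L
    htriv hcard (↑S₀ : Set (HeightOneSpectrum (𝓞 ℚ))) hS' κ.kerSubgroup
    (ResidualDevissageLine.mem_kerSubgroup_of_isComplexConjugation κ hc) hc hlift
  have h28 := GreenbergVatsalTorsionCurve.natCard_gvSelmer_torsion_curve W p κ.kerSubgroup L
    (↑S₀ : Set (HeightOneSpectrum (𝓞 ℚ))) hS' htriv
  rw [← hdev, h28, natCard_fixedPoints_quot_eq_one_of_line W p κ hΦ hT' hp2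
    hsplit.hasMultiplicativeReductionAtPrime hκ hram heven, mul_one]
  change Nat.card ↥(gvSelmerInfty κ (W.geomPrimaryTorsion p) L ↑S₀ ⊓ _) ≤ _
  exact hcount

end Summit.BirchSwinnertonDyer.Rank1Residual.X2.GreenbergSelmerCountLe

end
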